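import Summits.BirchSwinnertonDyer.BirchSwinnertonDyer.Theorems.BiquadraticEisensteinDescentHeegnerTwistCouplingInSupplyCornersEpOneFact
import Summits.BirchSwinnertonDyer.BirchSwinnertonDyer.Theorems.BiquadraticEisensteinDescentHeegnerTwistCouplingInSupplySqrtTwoCornerSeven
import Literature.NumberTheory.EllipticCurves.Wang2016.CongruentShaTwoByTwo
import HarnessLib

set_option linter.dupNamespace false
set_option autoImplicit false

/-!
# Crux-ideate seat 1, g19 — sketches of the FIRST LEMMAS of three crux idea cards on
# `HeegnerTwistCouplingInSupply` (stmt-BirchSwinnertonDyer-21381): second 2-descent / Cassels–Tate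
# at the BLIND prime-twist cells, the `ℤ[√2]`-spin form of the 8-rank, and the two supply transfers.

Statements only (`def … : Prop`), no proofs, no `sorry`; nothing here is asserted. BSD is not proved by this.

Dictionary. `E_n = congruentNumberCurve n : y² = x³ − n²x`; for primes `p ≡ q ≡ 7 (mod 8)` with
`(p/q) = +1` the field `K′ = ℚ(√−q)` is Heegner for `N(E_p) = 32p²` and `E_p^{(−q)} = E_{pq}`.
`B_{−m} = ⟨0, −4m, 0, 2m², 0⟩ : y² = x³ − 4m x² + 2m² x` (`j = 8000`), the tree's model of the
`j = 8000` twist family (`…SqrtTwoCorner`, `L_one_ne_zero_B_neg_of_selmerCorank`).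
`h₈(−pq) = 0` is `Wang2016.eightTwoCard (ClassGroup (𝓞 K)) = 1` for `disc K = −4pq`.
-/

namespace Summit.BirchSwinnertonDyer.BirchSwinnertonDyer.Cruxes.HeegnerTwistCouplingInSupply.SeatOneG19

open _root_.WeierstrassCurve Literature.NumberTheory.EllipticCurves
open scoped NumberField

/-- CARD A, first lemma (the 8-rank law at the blind `E_p` prime cells; Wang–Zhang 2022 Thm 1.1(A) with
`(a,b,c) = (1,1,1)`, `n = pq`, specialised; data job:j317837 132/132): for primes `p ≡ q ≡ 7 (mod 8)` with
`(p/q) = 1`, `h₈(ℚ(√−pq)) = 0` forces `corank Sel_{2^∞}(E_{pq}) = 0` (indeed rank `0` and `Ш[2^∞] ≅ (ℤ/2)²`). -/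
def EightRankLawE : Prop :=
  ∀ (p q : ℕ), p.Prime → q.Prime → p % 8 = 7 → q % 8 = 7 → jacobiSym (p : ℤ) q = 1 →
    ∀ (K : Type) [Field K] [NumberField K], NumberField.discr K = -(4 * p * q : ℤ) →
      Wang2016.eightTwoCard (ClassGroup (𝓞 K)) = 1 →
      [(congruentNumberCurve (p * q)).IsElliptic] → (congruentNumberCurve (p * q)).selmerCorank 2 = 0

/-- CARD A/B, the SPIN FORM of the 8-rank (Rédei reciprocity; data job:j317837 × local check 132/132):
with `β_p = x + y√2 ≫ 0`, `x² − 2y² = p`, and `c² ≡ 2 (mod q)`, `h₈(ℚ(√−pq)) = 0 ⟺ ((x + y c)/q) = −1`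
(the symbol is independent of the root `c` and of the totally positive generator chosen). -/
def SpinFormOfEightRank : Prop :=
  ∀ (p q : ℕ) (x y : ℤ) (c : ZMod q), p.Prime → q.Prime → p % 8 = 7 → q % 8 = 7 → jacobiSym (p : ℤ) q = 1 →
    x ^ 2 - 2 * y ^ 2 = p → 0 < x → 0 < y → c ^ 2 = 2 →
    ∀ (K : Type) [Field K] [NumberField K], NumberField.discr K = -(4 * p * q : ℤ) →
      (Wang2016.eightTwoCard (ClassGroup (𝓞 K)) = 1 ↔ jacobiSym (x + y * (c.val : ℤ)) q = -1)

/-- CARD A+B combined law in the form a prover would use at the corner (no class group in sight):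
the `ℤ[√2]`-spin of `β_p` at `q` decides the blind cell. -/
def SpinLawE : Prop :=
  ∀ (p q : ℕ) (x y : ℤ) (c : ZMod q), p.Prime → q.Prime → p % 8 = 7 → q % 8 = 7 → jacobiSym (p : ℤ) q = 1 →
    x ^ 2 - 2 * y ^ 2 = p → 0 < x → 0 < y → c ^ 2 = 2 → jacobiSym (x + y * (c.val : ℤ)) q = -1 →
    [(congruentNumberCurve (p * q)).IsElliptic] → (congruentNumberCurve (p * q)).selmerCorank 2 = 0

/-- CARD B, the TRANSFER `C_spin` (replaces C⁺ at a blind prime corner): below `p²` there is a prime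
`q ≡ 7 (mod 8)` with `(p/q) = +1` and spin `[β_p/𝔮] = −1`, and `h(−q) < p`.  A least-prime-ideal
statement for ONE quadratic Hecke character of `ℚ(√2)` of conductor norm `≍ p`, box norm `p^{2−ε}`:
Burgess/Pólya–Vinogradov regime; immediate under GRH. -/
def SpinSupplyBelowSquare : Prop :=
  ∃ p₀ : ℕ, ∀ p : ℕ, p.Prime → p % 8 = 7 → p₀ ≤ p →
    ∃ (q : ℕ) (x y : ℤ) (c : ZMod q), q.Prime ∧ q % 8 = 7 ∧ q < p ^ 2 ∧ jacobiSym (p : ℤ) q = 1 ∧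
      x ^ 2 - 2 * y ^ 2 = p ∧ 0 < x ∧ 0 < y ∧ c ^ 2 = 2 ∧ jacobiSym (x + y * (c.val : ℤ)) q = -1 ∧
      ∃ (K : Type) (_ : Field K) (_ : NumberField K), NumberField.discr K = -(q : ℤ) ∧ NumberField.classNumber K < p

/-- CARD A+B, the corner statement they assemble to (shape of `cruxOnEpCorner_of_BT`, but for EVERY
`p ≡ 7 (mod 8)` beyond `p₀`, with a PRIME Heegner field): recorded as a `Prop`; the composition
`burungaleTian… → SpinLawE → SpinSupplyBelowSquare → CornerEpPrimeTwist` is prover work. -/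
def CornerEpPrimeTwist : Prop :=
  ∃ p₀ : ℕ, ∀ (p : ℕ), p.Prime → p % 8 = 7 → p₀ ≤ p → [(congruentNumberCurve p).IsElliptic] →
    ∃ (K : Type) (_ : Field K) (_ : NumberField K),
      IsImaginaryQuadratic K ∧ 4 < (NumberField.discr K).natAbs ∧
      SatisfiesHeegnerHypothesis ((congruentNumberCurve p).conductorNorm ℤ) K ∧
      ((congruentNumberCurve p).quadraticTwist (NumberField.discr K : ℚ)).entireLFunction 1 ≠ 0 ∧
      NumberField.classNumber K < p ∧ ¬ p ∣ NumberField.classNumber K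

/-- CARD C, first lemma (BILINEAR composite supply for the blind `j = 8000` corner `p ≡ 7 (mod 16)`):
a composite Heegner parameter `d = −ℓ₁ℓ₂ ≡ 1 (mod 8)`, `(d/p) = +1`, `|d| < p²` (so `h(d) < p`), whose
twist `B_p^{(d)} = B_{−pℓ₁ℓ₂}` has `corank Sel_{2^∞} = 0` — to be produced by cancellation in the double
sum over `(ℓ₁, ℓ₂)` of the second-descent (Rédei-type) symbol, not by a least-prime theorem. -/
def BilinearCompositeSupplyB : Prop :=
  ∃ p₀ : ℕ, ∀ p : ℕ, p.Prime → p % 16 = 7 → p₀ ≤ p →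
    ∃ (ℓ₁ ℓ₂ : ℕ), ℓ₁.Prime ∧ ℓ₂.Prime ∧ ℓ₁ < ℓ₂ ∧ (ℓ₁ * ℓ₂) % 8 = 7 ∧ jacobiSym (-(ℓ₁ * ℓ₂ : ℤ)) p = 1 ∧
      ℓ₁ * ℓ₂ < p ^ 2 ∧
      (∃ (K : Type) (_ : Field K) (_ : NumberField K), NumberField.discr K = -(ℓ₁ * ℓ₂ : ℤ) ∧ NumberField.classNumber K < p) ∧
      ∀ [(⟨0, -4 * ((p * ℓ₁ * ℓ₂ : ℕ) : ℚ), 0, 2 * ((p * ℓ₁ * ℓ₂ : ℕ) : ℚ) ^ 2, 0⟩ : WeierstrassCurve ℚ).IsElliptic],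
        (⟨0, -4 * ((p * ℓ₁ * ℓ₂ : ℕ) : ℚ), 0, 2 * ((p * ℓ₁ * ℓ₂ : ℕ) : ℚ) ^ 2, 0⟩ : WeierstrassCurve ℚ).selmerCorank 2 = 0

/-- CARD C, the same lever on the `E_p` family in its genuinely second-descent configuration
(`ℓ₁ ≡ 1`, `ℓ₂ ≡ 7 (mod 8)`: all prime factors of `n = pℓ₁ℓ₂` are `≡ ±1 (mod 8)`, first descent constant):
the toy rung on which the bilinear Rédei-symbol sum is classical (Wang–Zhang 2022 Thm 1.1(A) gives the law). -/
def BilinearCompositeSupplyE : Prop :=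
  ∃ p₀ : ℕ, ∀ p : ℕ, p.Prime → p % 8 = 7 → p₀ ≤ p →
    ∃ (ℓ₁ ℓ₂ : ℕ), ℓ₁.Prime ∧ ℓ₂.Prime ∧ ℓ₁ % 8 = 1 ∧ ℓ₂ % 8 = 7 ∧ jacobiSym (-(ℓ₁ * ℓ₂ : ℤ)) p = 1 ∧
      ℓ₁ * ℓ₂ < p ^ 2 ∧
      ∀ [(congruentNumberCurve (p * ℓ₁ * ℓ₂)).IsElliptic], (congruentNumberCurve (p * ℓ₁ * ℓ₂)).selmerCorank 2 = 0

/-- Sanity: the tree's glue from corank to `L(1) ≠ 0` that all three cards feed (names only). -/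
example (hBT : burungaleTian_analyticRank_eq_zero_of_selmerCorank_eq_zero_of_hasCM)
    (hH : hasEntireLFunction_of_j_mem_maximalCMJInvariants) {m : ℤ} (hm : m ≠ 0)
    [(⟨0, -4 * (m : ℚ), 0, 2 * (m : ℚ) ^ 2, 0⟩ : WeierstrassCurve ℚ).IsElliptic]
    (hcor : (⟨0, -4 * (m : ℚ), 0, 2 * (m : ℚ) ^ 2, 0⟩ : WeierstrassCurve ℚ).selmerCorank 2 = 0) :
    (⟨0, -4 * (m : ℚ), 0, 2 * (m : ℚ) ^ 2, 0⟩ : WeierstrassCurve ℚ).entireLFunction 1 ≠ 0 :=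
  (Summit.BirchSwinnertonDyer.BirchSwinnertonDyer.Theorems.BiquadraticEisensteinDescentHeegnerTwistCouplingInSupplySqrtTwoCorner.L_one_ne_zero_B_neg_of_selmerCorank
    hBT hH hm hcor).2

end Summit.BirchSwinnertonDyer.BirchSwinnertonDyer.Cruxes.HeegnerTwistCouplingInSupply.SeatOneG19
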